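/-
Copyright (c) 2026. H413 campaign `hodgecm-mathlib`, squad K2, seat K2E1-p11 (gen 0).  Lane: `--supports stmt-HodgeConjecture-24833 --as helper` (count-neutral).
Deal (13)(i) of the dealer K2E1-plan (g6) 2026-09-04T09:53:01Z: the CHART-SIDE bridge of the last letter `hcnst` of the K1-L² chain.
-/
import Summits.HodgeConjecture.HodgeConjecture.Theorems.K2E1TruncatedCuspDecayHNU2OfUnfolding   -- ★ (this seat, p859116): the `hK1` head modulo `hcnst`, `hβ`, `hμZ`
import Summits.HodgeConjecture.HodgeConjecture.Theorems.K2E1UnipotentHaarNormalisationU2    -- ★ (K2E1-p09): `isInvInvariant_of_isHaarMeasure_two` (`N(𝔸)` abelian)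
import Literature.NumberTheory.Automorphic.UnitaryGroupLineUnipotentTwo                      -- ★ the chart `n : 𝔸_E⁻ ≅ N(𝔸_F)`: embedding, `n_* μ` Haar, `n(𝓕⁻)` fundamental domain
import Literature.NumberTheory.Automorphic.UnitaryGroupBorelTruncation                       -- ★ `borelConstantTerm`
import HarnessLib

/-!
# K1-L² for `U(1,1)`: THE CONSTANT-TERM BRIDGE — the engine's tile integral over `𝓕⁻` IS Bernstein–Lapid's `borelConstantTerm`

sorry-free · THEOREMS ONLY · lane `--supports stmt-HodgeConjecture-24833 --as helper`.

The `𝓗_k`-wrapper ★ `exists_forall_ae_norm_rightConvFun_le_of_unfolding` carries the cuspidality letter `hcnst` in the ENGINE's currency: the integral of the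
truncated lift over a tile `D₀ ⊆ 𝔸_L⁻` of `𝔸_L⁻∕L⁻` along the cast Siegel chart `X ↦ cast n(X)`.  This file rewrites that currency into the Bernstein–Lapid
leaves' `borelConstantTerm νN 𝓕 Φ g = (νN 𝓕)⁻¹ ∫_𝓕 Φ(u g) dνN(u)` at the tile `D₀ := 𝓕⁻` (Tate's trace-zero fundamental domain ★ `traceZeroFundamentalDomain`):
* §1 `cast_unipotentU2_eq_coe_middleRootUnipotent` — the cast engine chart IS the leaves' chart ★ `middleRootUnipotent` (same matrix `[[1, X], [0, 1]]`);
* §2 `isFundamentalDomain_inv_two` — `𝓕⁻¹` is an `N(F)`-fundamental domain when `𝓕` is (★ `mul_comm_adelicUnipotent_two`, inversion invariance);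
* §3 `setIntegral_tile_eq_smul_borelConstantTerm` — **`∫_{X ∈ 𝓕⁻} Φ((y·n(X))⁻¹) dνV = νN(𝓕) • borelConstantTerm νN 𝓕 Φ (y⁻¹)`**, `νN := n_* νV` (a Haar measure, ★
  `isHaarMeasure_map_middleRootUnipotent_two`), `𝓕 := (n(𝓕⁻))⁻¹` (a measurable `N(F)`-fundamental domain, ★ `isFundamentalDomain_image_traceZeroFundamentalDomain_two` + §2);
* §4 **`hcnst_of_ae_borelConstantTerm_eq_zero`** — the letter `hcnst` of ★ p859116 at `D₀ = 𝓕⁻` FOLLOWS from the a.e. vanishing of `borelConstantTerm νN 𝓕` of the truncated lift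
  above the height `c_P` (K2-defs1's (ii), `ae_borelConstantTerm_truncLift_eq_zero`), and §5 **`hK1_of_ae_borelConstantTerm_eq_zero`** = the `hK1` head with `hcnst`
  replaced by that a.e. statement (binder `hii`) — everything else (`hdom`, `hM`, the tile clauses) discharged.
[cite: BernsteinLapid2019, §4 Claims 4–5 (p. 10)] [cite: MoeglinWaldspurger1995, I.2.6] [cite: CasselsFrohlichANT1967, Ch. XV Thm. 4.1.3]
-/

noncomputable section

set_option autoImplicit false

set_option linter.dupNamespace false

open NumberField IsDedekindDomain MeasureTheory Measure Set Function Filter Topology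
open scoped NNReal MatrixGroups Pointwise ENNReal Classical

namespace Summit.HodgeConjecture.HodgeConjecture.Cruxes.H413.K2E1TruncatedCuspConstantTermBridgeU2

open Literature.MeasureTheory.Group Literature.NumberTheory.Automorphic Literature.NumberTheory.Automorphic.UnitaryGroup AdelicGroupData
open Summit.HodgeConjecture.HodgeConjecture.Cruxes.H413.K2E1SiegelRadicalChartU2
open Summit.HodgeConjecture.HodgeConjecture.Cruxes.H413.K2E1BLBorelSpacesU2Defs
open Summit.HodgeConjecture.HodgeConjecture.Cruxes.H413.K2E1BLBorelOperatorsU2Defs (rightConvFun)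
open Summit.HodgeConjecture.HodgeConjecture.Cruxes.H413.K2E1TruncatedCuspDecayHNU2Transport (adelicVal_cast_quasiSplit)
open Summit.HodgeConjecture.HodgeConjecture.Cruxes.H413.K2E1TruncatedCuspDecayHNU2OfUnfolding (exists_forall_ae_norm_rightConvFun_le_of_unfolding)
open Summit.HodgeConjecture.HodgeConjecture.Cruxes.H413.K2E1UnipotentHaarNormalisationU2 (isInvInvariant_of_isHaarMeasure_two)

variable (L : Type) [Field L] [NumberField L] [IsCMField L]
  (hij : (((0 : Fin 2) : Fin 2) : ℕ) + 1 = (((1 : Fin 2) : Fin 2) : ℕ)) (hN : 2 = 2 * (((0 : Fin 2) : Fin 2) : ℕ) + 2)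

/-! ## §1 The cast engine chart is the leaves' chart -/

/-- **`cast n(X) = m(X)`**: the engine's Siegel chart `unipotentU2 L` cast to Mok's datum (★ junction) and the leaves' chart ★ `middleRootUnipotent` are the same element
of `G(𝔸)` — both have the matrix `[[1, X], [0, 1]]` (★ `adelicVal_cast_quasiSplit`, injectivity of `G(𝔸) ↪ GL₂(𝔸_L)`). [cite: Rogawski1990, §1.10] -/
theorem cast_unipotentU2_eq_coe_middleRootUnipotent (X : ↥(traceZeroAdele (↥(maximalRealSubfield L)) L (IsCMField.complexConj L))) :
    cast (congrArg AdelicGroupData.Adelic (quasiSplit_eq_cmDatum_of L 2).symm) (unipotentU2 L (Multiplicative.ofAdd X)) = ((middleRootUnipotent hij hN (Multiplicative.ofAdd X) : ↥(adelicUnipotent (↥(maximalRealSubfield L)) L (IsCMField.complexConj L) 2)) : (quasiSplit (↥(maximalRealSubfield L)) L (IsCMField.complexConj L) 2).Adelic) := by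
  apply adelicVal_injective (↥(maximalRealSubfield L)) L (IsCMField.complexConj L) 2 ((StdForm.antidiagonal 2).over L)
  rw [adelicVal_cast_quasiSplit]
  apply Units.ext
  change _ = ((adelicVal (↥(maximalRealSubfield L)) L (IsCMField.complexConj L) 2 ((StdForm.antidiagonal 2).over L)
    (middleRootAdelicHom hij hN (Multiplicative.ofAdd X)) : GL (Fin 2) (AdeleRing (𝓞 L) L)) : Matrix (Fin 2) (Fin 2) (AdeleRing (𝓞 L) L))
  rw [adelicVal_unipotentU2, coe_adelicVal_middleRootAdelicHom]

/-! ## §2 Inverting a fundamental domain of the abelian `N(F) ↷ N(𝔸)` -/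

section Inv

variable {F : Type} [Field F] [NumberField F] {E : Type} [Field E] [NumberField E] [Algebra F E] {c : E ≃ₐ[F] E}
  [MeasurableSpace ↥(adelicUnipotent F E c 2)] [BorelSpace ↥(adelicUnipotent F E c 2)]

/-- **`𝓕⁻¹` is an `N(F)`-fundamental domain when `𝓕` is**, for an inversion-invariant measure on the ABELIAN group `N(𝔸_F)` of `U(1,1)` (★ `mul_comm_adelicUnipotent_two`):
inversion is a measurable self-equivalence conjugating the translation by `γ` to the translation by `γ⁻¹` (Mathlib `IsFundamentalDomain.image_of_equiv`).
[cite: CasselsFrohlichANT1967, Ch. XV Thm. 4.1.3] -/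
theorem isFundamentalDomain_inv_two {ν : Measure ↥(adelicUnipotent F E c 2)} [ν.IsInvInvariant] {𝓕 : Set ↥(adelicUnipotent F E c 2)}
    (h𝓕 : IsFundamentalDomain ↥(rationalUnipotent F E c 2) 𝓕 ν) : IsFundamentalDomain ↥(rationalUnipotent F E c 2) 𝓕⁻¹ ν := by
  rw [← image_inv_eq_inv]
  refine h𝓕.image_of_equiv (Equiv.inv ↥(adelicUnipotent F E c 2)) ?_ (Equiv.inv ↥(rationalUnipotent F E c 2)) fun γ u => ?_
  · exact (Measure.measurePreserving_inv ν).quasiMeasurePreserving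
  · change ((γ⁻¹ : ↥(rationalUnipotent F E c 2)) • u)⁻¹ = γ • u⁻¹
    rw [Subgroup.smul_def, Subgroup.smul_def, smul_eq_mul, smul_eq_mul, mul_inv_rev, Subgroup.coe_inv, inv_inv, mul_comm_adelicUnipotent_two]

end Inv

/-! ## §3 The tile integral over `𝓕⁻` is `νN(𝓕) • borelConstantTerm νN 𝓕` -/

section Tile

variable [MeasurableSpace (quasiSplit (↥(maximalRealSubfield L)) L (IsCMField.complexConj L) 2).Adelic] [BorelSpace (quasiSplit (↥(maximalRealSubfield L)) L (IsCMField.complexConj L) 2).Adelic]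
  [MeasurableSpace (AdeleRing (𝓞 L) L)] [BorelSpace (AdeleRing (𝓞 L) L)]
  [MeasurableSpace ↥(adelicUnipotent (↥(maximalRealSubfield L)) L (IsCMField.complexConj L) 2)] [BorelSpace ↥(adelicUnipotent (↥(maximalRealSubfield L)) L (IsCMField.complexConj L) 2)]

omit [MeasurableSpace (quasiSplit (↥(maximalRealSubfield L)) L (IsCMField.complexConj L) 2).Adelic] [BorelSpace (quasiSplit (↥(maximalRealSubfield L)) L (IsCMField.complexConj L) 2).Adelic] in
/-- **THE TILE INTEGRAL IS THE CONSTANT TERM.**  For `νV` a Haar measure on `𝔸_L⁻`, `n = middleRootUnipotent`, `νN := n_* νV`, `𝓕 := (n(𝓕⁻))⁻¹` and ANY `Φ : G(𝔸) → ℂ`, `y ∈ G(𝔸)`: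
`∫_{X ∈ 𝓕⁻} Φ((y·cast n(X))⁻¹) dνV(X) = (νN 𝓕).toReal • borelConstantTerm νN 𝓕 Φ (y⁻¹)` — `(y·n(X))⁻¹ = n(X)⁻¹·y⁻¹` (§1), push forward along the measurable embedding `n`
(★ `measurableEmbedding_middleRootUnipotent_two`), inversion invariance of the Haar measure `νN` (★), `νN 𝓕 = νV 𝓕⁻ ∉ {0, ∞}` (★). [cite: MoeglinWaldspurger1995, I.2.6]
[cite: CasselsFrohlichANT1967, Ch. XV Thm. 4.1.3] -/
theorem setIntegral_tile_eq_smul_borelConstantTerm (νV : Measure ↥(traceZeroAdele (↥(maximalRealSubfield L)) L (IsCMField.complexConj L))) [νV.IsAddHaarMeasure] (Φ : (quasiSplit (↥(maximalRealSubfield L)) L (IsCMField.complexConj L) 2).Adelic → ℂ) (y : (quasiSplit (↥(maximalRealSubfield L)) L (IsCMField.complexConj L) 2).Adelic) :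
    ∫ X in traceZeroFundamentalDomain (↥(maximalRealSubfield L)) L (IsCMField.complexConj L), Φ (y * cast (congrArg AdelicGroupData.Adelic (quasiSplit_eq_cmDatum_of L 2).symm) (unipotentU2 L (Multiplicative.ofAdd X)))⁻¹ ∂νV =
      ((νV.map (fun X : ↥(traceZeroAdele (↥(maximalRealSubfield L)) L (IsCMField.complexConj L)) => middleRootUnipotent hij hN (Multiplicative.ofAdd X))) (((fun X : ↥(traceZeroAdele (↥(maximalRealSubfield L)) L (IsCMField.complexConj L)) => middleRootUnipotent hij hN (Multiplicative.ofAdd X)) '' traceZeroFundamentalDomain (↥(maximalRealSubfield L)) L (IsCMField.complexConj L))⁻¹)).toReal •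
        borelConstantTerm (νV.map (fun X : ↥(traceZeroAdele (↥(maximalRealSubfield L)) L (IsCMField.complexConj L)) => middleRootUnipotent hij hN (Multiplicative.ofAdd X))) (((fun X : ↥(traceZeroAdele (↥(maximalRealSubfield L)) L (IsCMField.complexConj L)) => middleRootUnipotent hij hN (Multiplicative.ofAdd X)) '' traceZeroFundamentalDomain (↥(maximalRealSubfield L)) L (IsCMField.complexConj L))⁻¹) Φ y⁻¹ := by
  have hc : IsCMField.complexConj L * IsCMField.complexConj L = 1 := AlgEquiv.ext fun x => IsCMField.complexConj_apply_apply L x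
  haveI : Algebra.IsQuadraticExtension ↥(maximalRealSubfield L) L := IsCMField.isQuadraticExtension L
  haveI := locallyCompactSpace_adeleRing' L
  set n : ↥(traceZeroAdele (↥(maximalRealSubfield L)) L (IsCMField.complexConj L)) → ↥(adelicUnipotent (↥(maximalRealSubfield L)) L (IsCMField.complexConj L) 2) := (fun X : ↥(traceZeroAdele (↥(maximalRealSubfield L)) L (IsCMField.complexConj L)) => middleRootUnipotent hij hN (Multiplicative.ofAdd X)) with hn
  set νN : Measure ↥(adelicUnipotent (↥(maximalRealSubfield L)) L (IsCMField.complexConj L) 2) := νV.map n with hνN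
  haveI : νN.IsHaarMeasure := isHaarMeasure_map_middleRootUnipotent_two hij hN νV
  haveI : νN.IsInvInvariant := isInvInvariant_of_isHaarMeasure_two νN
  have hemb : MeasurableEmbedding n := measurableEmbedding_middleRootUnipotent_two hij hN
  -- `νN 𝓕 = νV 𝓕⁻ ∉ {0, ∞}`
  have hmeas : νN ((n '' traceZeroFundamentalDomain (↥(maximalRealSubfield L)) L (IsCMField.complexConj L))⁻¹) = νV (traceZeroFundamentalDomain (↥(maximalRealSubfield L)) L (IsCMField.complexConj L)) := by
    rw [measure_inv, hνN, hemb.map_apply, hemb.injective.preimage_image]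
  have h0 := measure_traceZeroFundamentalDomain_ne_zero_and_lt_top (F := ↥(maximalRealSubfield L)) (E := L) (c := IsCMField.complexConj L) hc νV
  have htoR : (νN ((n '' traceZeroFundamentalDomain (↥(maximalRealSubfield L)) L (IsCMField.complexConj L))⁻¹)).toReal ≠ 0 := by
    rw [hmeas]; exact ENNReal.toReal_ne_zero.2 ⟨h0.1, h0.2.ne⟩
  -- the integrand along the chart
  have hint : ∀ X : ↥(traceZeroAdele (↥(maximalRealSubfield L)) L (IsCMField.complexConj L)), Φ (y * cast (congrArg AdelicGroupData.Adelic (quasiSplit_eq_cmDatum_of L 2).symm) (unipotentU2 L (Multiplicative.ofAdd X)))⁻¹ = Φ (((n X)⁻¹ : ↥(adelicUnipotent (↥(maximalRealSubfield L)) L (IsCMField.complexConj L) 2)) * y⁻¹) := by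
    intro X
    rw [mul_inv_rev, cast_unipotentU2_eq_coe_middleRootUnipotent L hij hN X, Subgroup.coe_inv]
  simp_rw [hint]
  -- push forward and invert
  have h1 : ∫ X in traceZeroFundamentalDomain (↥(maximalRealSubfield L)) L (IsCMField.complexConj L), Φ (((n X)⁻¹ : ↥(adelicUnipotent (↥(maximalRealSubfield L)) L (IsCMField.complexConj L) 2)) * y⁻¹) ∂νV = ∫ u in n '' traceZeroFundamentalDomain (↥(maximalRealSubfield L)) L (IsCMField.complexConj L), Φ ((u⁻¹ : ↥(adelicUnipotent (↥(maximalRealSubfield L)) L (IsCMField.complexConj L) 2)) * y⁻¹) ∂νN := by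
    rw [hνN, hemb.setIntegral_map, hemb.injective.preimage_image]
  have h2 : ∫ u in n '' traceZeroFundamentalDomain (↥(maximalRealSubfield L)) L (IsCMField.complexConj L), Φ ((u⁻¹ : ↥(adelicUnipotent (↥(maximalRealSubfield L)) L (IsCMField.complexConj L) 2)) * y⁻¹) ∂νN = ∫ u in (n '' traceZeroFundamentalDomain (↥(maximalRealSubfield L)) L (IsCMField.complexConj L))⁻¹, Φ ((u : ↥(adelicUnipotent (↥(maximalRealSubfield L)) L (IsCMField.complexConj L) 2)) * y⁻¹) ∂νN := by
    rw [← image_inv_eq_inv]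
    exact ((Measure.measurePreserving_inv νN).setIntegral_image_emb (MeasurableEquiv.inv ↥(adelicUnipotent (↥(maximalRealSubfield L)) L (IsCMField.complexConj L) 2)).measurableEmbedding
      (fun u => Φ ((u : ↥(adelicUnipotent (↥(maximalRealSubfield L)) L (IsCMField.complexConj L) 2)) * y⁻¹)) (n '' traceZeroFundamentalDomain (↥(maximalRealSubfield L)) L (IsCMField.complexConj L))).symm
  rw [h1, h2, borelConstantTerm_def, smul_smul, mul_inv_cancel₀ htoR, one_smul]

/-! ## §4 The letter `hcnst` from the a.e. vanishing of the constant term -/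

/-- **`hcnst` OF ★ `exists_forall_ae_norm_rightConvFun_le_of_unfolding` AT THE TILE `𝓕⁻`, FROM THE LEAVES' CURRENCY.**  If for every `f ∈ 𝓗_k^cusp(Z_{c₁})` the constant
term `borelConstantTerm νN 𝓕 ((𝟙_{Z_{c₁}}·f) ∘ π)` of the truncated lift vanishes at `ν_G`-a.e. `g` with `H(g) > c_P` (K2-defs1's (ii); `νN = n_* νV`, `𝓕 = (n(𝓕⁻))⁻¹`), then
the engine's tile integrals vanish at `ν_G`-a.e. `y` with `H(y⁻¹) > c_P` (§3 and inversion invariance of `ν_G`). [cite: BernsteinLapid2019, §4 Claims 4–5 (p. 10)] -/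
theorem hcnst_of_ae_borelConstantTerm_eq_zero (νG : Measure (quasiSplit (↥(maximalRealSubfield L)) L (IsCMField.complexConj L) 2).Adelic) [νG.IsInvInvariant] (νV : Measure ↥(traceZeroAdele (↥(maximalRealSubfield L)) L (IsCMField.complexConj L))) [νV.IsAddHaarMeasure]
    (k : ℕ) (c₁ : ℝ≥0) (μZ : Measure (borelQuotient (↥(maximalRealSubfield L)) L (IsCMField.complexConj L) 2)) (cP : ℝ≥0)
    (hii : ∀ f : ↥(HNcusp (↥(maximalRealSubfield L)) L (IsCMField.complexConj L) 2 k c₁ μZ), ∀ᵐ g ∂νG, cP < borelHeight g →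
      borelConstantTerm (νV.map (fun X : ↥(traceZeroAdele (↥(maximalRealSubfield L)) L (IsCMField.complexConj L)) => middleRootUnipotent hij hN (Multiplicative.ofAdd X))) (((fun X : ↥(traceZeroAdele (↥(maximalRealSubfield L)) L (IsCMField.complexConj L)) => middleRootUnipotent hij hN (Multiplicative.ofAdd X)) '' traceZeroFundamentalDomain (↥(maximalRealSubfield L)) L (IsCMField.complexConj L))⁻¹)
        (({z : borelQuotient (↥(maximalRealSubfield L)) L (IsCMField.complexConj L) 2 | c₁ < borelQuotHeight (↥(maximalRealSubfield L)) L (IsCMField.complexConj L) 2 z}.indicator ((f : HN (↥(maximalRealSubfield L)) L (IsCMField.complexConj L) 2 k c₁ μZ) : borelQuotient (↥(maximalRealSubfield L)) L (IsCMField.complexConj L) 2 → ℂ)) ∘ toBorelQuotient (↥(maximalRealSubfield L)) L (IsCMField.complexConj L) 2) g = 0) :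
    ∀ f : ↥(HNcusp (↥(maximalRealSubfield L)) L (IsCMField.complexConj L) 2 k c₁ μZ), ∀ᵐ y ∂νG, cP < borelHeight y⁻¹ →
      ∫ X in traceZeroFundamentalDomain (↥(maximalRealSubfield L)) L (IsCMField.complexConj L), {z : borelQuotient (↥(maximalRealSubfield L)) L (IsCMField.complexConj L) 2 | c₁ < borelQuotHeight (↥(maximalRealSubfield L)) L (IsCMField.complexConj L) 2 z}.indicator ((f : HN (↥(maximalRealSubfield L)) L (IsCMField.complexConj L) 2 k c₁ μZ) : borelQuotient (↥(maximalRealSubfield L)) L (IsCMField.complexConj L) 2 → ℂ)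
        (toBorelQuotient (↥(maximalRealSubfield L)) L (IsCMField.complexConj L) 2 (y * cast (congrArg AdelicGroupData.Adelic (quasiSplit_eq_cmDatum_of L 2).symm) (unipotentU2 L (Multiplicative.ofAdd X)))⁻¹) ∂νV = 0 := by
  intro f
  filter_upwards [(Measure.measurePreserving_inv νG).quasiMeasurePreserving.ae (hii f)] with y hy hP
  have h := setIntegral_tile_eq_smul_borelConstantTerm L hij hN νV (({z : borelQuotient (↥(maximalRealSubfield L)) L (IsCMField.complexConj L) 2 | c₁ < borelQuotHeight (↥(maximalRealSubfield L)) L (IsCMField.complexConj L) 2 z}.indicator ((f : HN (↥(maximalRealSubfield L)) L (IsCMField.complexConj L) 2 k c₁ μZ) : borelQuotient (↥(maximalRealSubfield L)) L (IsCMField.complexConj L) 2 → ℂ)) ∘ toBorelQuotient (↥(maximalRealSubfield L)) L (IsCMField.complexConj L) 2) y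
  simp only [Function.comp] at h
  rw [h, hy hP, smul_zero]

/-! ## §5 The `hK1` head modulo the a.e. vanishing of the constant term (and the measure letters of record) -/

/-- **K1-L² MODULO (ii) AND THE MEASURE LETTERS OF RECORD.**  ★ `exists_forall_ae_norm_rightConvFun_le_of_unfolding` at the tile `D₀ := 𝓕⁻` (its tile clauses discharged by ★
`measurableSet_traceZeroFundamentalDomain`, ★ `exists_isCompact_traceZeroFundamentalDomain_subset`, ★ `existsUnique_vadd_mem_traceZeroFundamentalDomain`) with `hcnst := §4 hii`:
for every `m ≥ 0` there are `c⋆`, `C ≥ 0` with `‖R(η ∗ η)f(z)‖ ≤ C·‖f‖·HZ(z)^{−m}` a.e. for `HZ^{−2k}μZ|_{Z_{c₀}}`, all `c₀ ≥ c⋆`, all `f ∈ 𝓗_k^cusp(Z_{c₁})`.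
[cite: BernsteinLapid2019, §4 Claim 5 (p. 10)] [cite: MoeglinWaldspurger1995, I.2.13] -/
theorem hK1_of_ae_borelConstantTerm_eq_zero
    (νG : Measure (quasiSplit (↥(maximalRealSubfield L)) L (IsCMField.complexConj L) 2).Adelic) [νG.IsHaarMeasure] [νG.IsInvInvariant] [νG.IsMulRightInvariant]
    (νV : Measure ↥(traceZeroAdele (↥(maximalRealSubfield L)) L (IsCMField.complexConj L))) [νV.IsAddHaarMeasure]
    {β : (quasiSplit (↥(maximalRealSubfield L)) L (IsCMField.complexConj L) 2).Adelic → ℝ≥0∞} (hβ : IsCoveringWeight ↥((arithmeticBorel (↥(maximalRealSubfield L)) L (IsCMField.complexConj L) 2).map (quasiSplit (↥(maximalRealSubfield L)) L (IsCMField.complexConj L) 2).arithmeticSubgroup.subtype) β)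
    {μZ : Measure (borelQuotient (↥(maximalRealSubfield L)) L (IsCMField.complexConj L) 2)} (hμZ : ∀ f : borelQuotient (↥(maximalRealSubfield L)) L (IsCMField.complexConj L) 2 → ℝ≥0∞, Measurable f → ∫⁻ z, f z ∂μZ = ∫⁻ g, β g * f (toBorelQuotient (↥(maximalRealSubfield L)) L (IsCMField.complexConj L) 2 g) ∂νG)
    {η₀ : GL (Fin 2) (AdeleRing (𝓞 L) L) → ℝ} (hη₀ : IsTestFunctionGL 2 L η₀) (k : ℕ) (c₁ cP : ℝ≥0)
    (hii : ∀ f : ↥(HNcusp (↥(maximalRealSubfield L)) L (IsCMField.complexConj L) 2 k c₁ μZ), ∀ᵐ g ∂νG, cP < borelHeight g →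
      borelConstantTerm (νV.map (fun X : ↥(traceZeroAdele (↥(maximalRealSubfield L)) L (IsCMField.complexConj L)) => middleRootUnipotent hij hN (Multiplicative.ofAdd X))) (((fun X : ↥(traceZeroAdele (↥(maximalRealSubfield L)) L (IsCMField.complexConj L)) => middleRootUnipotent hij hN (Multiplicative.ofAdd X)) '' traceZeroFundamentalDomain (↥(maximalRealSubfield L)) L (IsCMField.complexConj L))⁻¹)
        (({z : borelQuotient (↥(maximalRealSubfield L)) L (IsCMField.complexConj L) 2 | c₁ < borelQuotHeight (↥(maximalRealSubfield L)) L (IsCMField.complexConj L) 2 z}.indicator ((f : HN (↥(maximalRealSubfield L)) L (IsCMField.complexConj L) 2 k c₁ μZ) : borelQuotient (↥(maximalRealSubfield L)) L (IsCMField.complexConj L) 2 → ℂ)) ∘ toBorelQuotient (↥(maximalRealSubfield L)) L (IsCMField.complexConj L) 2) g = 0)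
    {m : ℝ} (hm : 0 ≤ m) :
    ∃ (cstar : ℝ≥0) (C : ℝ), 0 ≤ C ∧ ∀ c₀ : ℝ≥0, cstar ≤ c₀ → ∀ f : ↥(HNcusp (↥(maximalRealSubfield L)) L (IsCMField.complexConj L) 2 k c₁ μZ),
      ∀ᵐ z ∂(weightedTruncMeasure (↥(maximalRealSubfield L)) L (IsCMField.complexConj L) 2 k c₀ μZ),
        ‖rightConvFun (↥(maximalRealSubfield L)) L (IsCMField.complexConj L) 2 νG (fun y => orbitalSmoothing νG
            (fun g : (quasiSplit (↥(maximalRealSubfield L)) L (IsCMField.complexConj L) 2).Adelic => ((η₀ (adelicVal (↥(maximalRealSubfield L)) L (IsCMField.complexConj L) 2 ((StdForm.antidiagonal 2).over L) g) : ℝ) : ℂ))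
            (fun g : (quasiSplit (↥(maximalRealSubfield L)) L (IsCMField.complexConj L) 2).Adelic => ((η₀ (adelicVal (↥(maximalRealSubfield L)) L (IsCMField.complexConj L) 2 ((StdForm.antidiagonal 2).over L) g) : ℝ) : ℂ)) y)
          ((f : HN (↥(maximalRealSubfield L)) L (IsCMField.complexConj L) 2 k c₁ μZ) : borelQuotient (↥(maximalRealSubfield L)) L (IsCMField.complexConj L) 2 → ℂ) z‖ ≤
          C * ‖f‖ * ((borelQuotHeight (↥(maximalRealSubfield L)) L (IsCMField.complexConj L) 2 z : ℝ)) ^ (-m) := by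
  have hc : IsCMField.complexConj L * IsCMField.complexConj L = 1 := AlgEquiv.ext fun x => IsCMField.complexConj_apply_apply L x
  obtain ⟨KD₀, hKD₀, hsub⟩ := exists_isCompact_traceZeroFundamentalDomain_subset (F := ↥(maximalRealSubfield L)) (E := L) (c := IsCMField.complexConj L) hc
  exact exists_forall_ae_norm_rightConvFun_le_of_unfolding L νG νV hβ hμZ hη₀ k c₁ measurableSet_traceZeroFundamentalDomain hKD₀ hsub
    (existsUnique_vadd_mem_traceZeroFundamentalDomain hc) cP (hcnst_of_ae_borelConstantTerm_eq_zero L hij hN νG νV k c₁ μZ cP hii) hm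

end Tile

end Summit.HodgeConjecture.HodgeConjecture.Cruxes.H413.K2E1TruncatedCuspConstantTermBridgeU2

end
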